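import Summits.QuantumFields.BalabanUV.Beta.EriceRemainderEnclosureHistoryAutonomyComparisonAgeCompositionNearPairSeparatedAgesEvery

/-!
# EriceRemainderEnclosureHistoryAutonomyComparisonAgeCompositionTwoClusterLevels — (E99g) route (N), first order: TWO CAPPED CLUSTERS — THE LAST STEP
# IS CHEAP.  The cascade's ratio 61 pays for PROPAGATION through an unbounded number of older levels (`κ + 4s(1+κ) ≤ R₀(1 − s(1+κ))κ`); the TOP level
# needs no room above it.  With exactly two levels — a capped youngest cluster `S₀` (cap `s₀`, window `hi₀`) and ONE capped top cluster `S₁` (cap `s`,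
# youngest `lo₁ ≥ ρ₀·hi₀`) — the sharp-last-step engine (E96a)∕(E99e) needs only `s₀(ρ₀λ + 4s(1+κ) + κ) ≤ ρ₀λ` (`λ = 1 − s(1+κ)`, ANY `κ > 0`; the
# older closure is met by a large `R₀` that separates nothing): as `κ → 0` this is `ρ₀ ≥ 4s·s₀∕((1−s)(1−s₀))` — `32.2` for the census young pair
# (`s₀ = 0.8333`) under a near old pair (`s = 0.617`).  **`flow_nonneg_two_cluster_levels_of_caps`** (parametric), and the census four ages
# `{1, k₂, k₃, k₄}` with `2 ≤ k₂ ≤ 29`, a near old pair `k₃ < k₄ ≤ 2k₃` on top and the gap `33k₂ ≤ k₃` instead of `61k₂`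
# (**`flow_nonneg_census_four_ages_near_old_pair_gap33`**; `κ = 1∕1000`, `ρ₀ = 33`: `0.8333·(12.6186 + 2.4715) = 12.5746 ≤ 12.6186`)

Cell `pub-balaban`, β-function sub-cell, BINDER row D4 «RemainderConst leaves for Bałaban's split» (`HOME/BINDER-OWNERS.md`; owner lineage `b2b-balaban-beta-an4`;
this file by co-owner #2 lineage `b2b-balaban-beta-d4-p2`, generation 87), β-FLOW TEAM duty (1), FREEZE (0) honoured (def-free; nothing restated).

HONEST FRAMING (page 1, verbatim and binding).  *"Discharging BetaPertH makes Bałaban's UV stability UNCONDITIONAL — a real constructive-QFT result; it is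
NOT the continuum limit and NOT the Clay problem."*  THIS FILE DISCHARGES NOTHING OF THE KIND.  Elementary real algebra ∕ real analysis about ABSTRACT
functionals on a box ]0,γ]^ℕ with displayed floors, profiles and signs, and the FIRST-ORDER renewal objects of route (N) built from them — hypotheses of a
census, not facts; the form, signs, ages and moments of Bałaban's (1.22) limit functional are NOT PRINTED ([I] p. 298; GAPS G-t4-U2-1∕-2) and NOT asserted.
Row D4 class UNCHANGED (critical-path width 0; instance 0∕1; D4 DISCHARGE NO DATE).  HONEST DEPENDENCY: continuum YM on T⁴ ⇐ BetaPertH ∧ nine spine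
estimates (0/9 proved); BetaPertH ⇐ (D1) ∧ (D4) ∧ CAP+tail; G-an2-4 gates asym, D1 and NE2/3/4.

THE POINT (README `HOME/b2b-balaban-beta-d4-p2/g87/README.md` §5).  Uses (E99e) `flow_nonneg_cluster_levels_of_caps_youngest` (with `r = 2` and
`R₀ = ⌈(κ + 4s(1+κ))∕((1 − s(1+κ))κ)⌉₊`), (E99b) `near_pair_load_le`, (E97c) `young_pair_load_le` BY NAME.  NOT CLAIMED: more than one older level at gap 33
(propagation needs the ×61 closure); `k₂ ≥ 30` (no typed cap for the young pair); anything printed — NOT B12 Thm 2, NOT BetaPertH, NOT continuum, NOT Clay.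

WHAT IS PROVED ([folklore]; 0 `def`, 0 sorry).  §1 **`flow_nonneg_two_cluster_levels_of_caps`**.  §2 **`flow_nonneg_census_four_ages_near_old_pair_gap33`**.
-/
noncomputable section
open Finset

namespace Summit.QuantumFields.BalabanUV.Beta.EriceRemainderEnclosureHistoryAutonomyComparisonAgeCompositionTwoClusterLevels

open Literature.MathematicalPhysics.QuantumFieldTheory.Balaban1983to89
open Literature.MathematicalPhysics.QuantumFieldTheory.Balaban1983to89.T4BetaStationary
open Literature.MathematicalPhysics.QuantumFieldTheory.Balaban1983to89.T4BetaFlowWellPosed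
open Summit.QuantumFields.BalabanUV.Beta.EriceRemainderEnclosureHistoryAutonomyComparisonAgeCompositionOldPairCap (near_pair_load_le)
open Summit.QuantumFields.BalabanUV.Beta.EriceRemainderEnclosureHistoryAutonomyComparisonAgeCompositionClusterLevelsYoungest
  (flow_nonneg_cluster_levels_of_caps_youngest)
open Summit.QuantumFields.BalabanUV.Beta.EriceRemainderEnclosureHistoryAutonomyComparisonAgeCompositionYoungPairCapSeparatedAges (young_pair_load_le)

variable {B : (ℕ → ℝ) → ℝ} {γ b gIR : ℝ} {L : ℕ → ℝ} {K : ℕ} {h g : ℕ → ℝ}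

/-! ## §1 Two capped clusters: only the last-step closure -/

/-- **TWO CAPPED CLUSTERS, ONLY THE LAST-STEP CLOSURE.**  Along every box solution of an isotone dominated memory with floor (`L ≥ 0`, `K ≥ 1`) and every
damping of the self-consistent class: a youngest cluster `S₀ ⊂ [1, K)` with window `hi₀` and cap `Σ_{k∈S₀} x_k(q) ≤ s₀`, ONE older cluster `S₁ ⊂ [1,K)`
with members `lo₁ ≤ k ≤ hi₁` (`lo₁ ≤ hi₁`) and cap `Σ_{k∈S₁} x_k(q) ≤ s`, disjoint from `S₀` by the gap `ρ₀·hi₀ ≤ lo₁` (`ρ₀ ≥ 1`) and every member of `S₀`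
below every member of `S₁`; the profile vanishes off `S₀ ∪ S₁`.  CLOSURE: `κ > 0`, `0 ≤ s`, `s(1+κ) < 1` and
`s₀(ρ₀(1 − s(1+κ)) + 4s(1+κ) + κ) ≤ ρ₀(1 − s(1+κ))` — NO ratio-61 condition.  THEN `0 ≤ ε ≤ e` at every pin ((E99e) with `r = 2` and
`R₀ = ⌈(κ + 4s(1+κ))∕((1 − s(1+κ))κ)⌉₊`, which separates nothing). [folklore] -/
theorem flow_nonneg_two_cluster_levels_of_caps
    (hmono : ∀ u v : ℕ → ℝ, SeqBox γ u → SeqBox γ v → (∀ j, u j ≤ v j) → B u ≤ B v)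
    (hL : ∀ k, 0 ≤ L k) (hb : 0 < b) (hlo : ∀ u, SeqBox γ u → b ≤ B u) (hdom : ∀ u, SeqBox γ u → ∑ k ∈ range K, L k * u k ≤ B u)
    (hh : SeqBox γ h) (hf : MemFlow B gIR h) (hg : ∀ t, 0 < g t ∧ g t ≤ 1)
    (hgF : ∀ t, 1 ≤ g t * (1 + ∑ k ∈ range K, L k * h (t + k) ^ 3 / 2)) (hK : 1 ≤ K)
    {κ s₀ s : ℝ} {ρ₀ : ℕ} (hκ : 0 < κ) (hs : 0 ≤ s) (hsC : s * (1 + κ) < 1) (hρ₀ : 1 ≤ ρ₀)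
    (hyoung : s₀ * ((ρ₀ : ℝ) * (1 - s * (1 + κ)) + (4 * s * (1 + κ) + κ)) ≤ (ρ₀ : ℝ) * (1 - s * (1 + κ)))
    {S₀ S₁ : Finset ℕ} {hi₀ lo₁ hi₁ : ℕ} (hS₀K : ∀ k ∈ S₀, 1 ≤ k ∧ k < K) (hS₀hi : ∀ k ∈ S₀, k ≤ hi₀)
    (hS₁K : ∀ k ∈ S₁, 1 ≤ k ∧ k < K) (hS₁lo : ∀ k ∈ S₁, lo₁ ≤ k) (hS₁hi : ∀ k ∈ S₁, k ≤ hi₁) (hlohi : lo₁ ≤ hi₁)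
    (hgap : ρ₀ * hi₀ ≤ lo₁) (hlt : ∀ x ∈ S₀, ∀ y ∈ S₁, x < y)
    (hLS : ∀ l, l < K → l ∉ S₀ → l ∉ S₁ → L l = 0)
    (hcap0 : ∀ q, ∑ k ∈ S₀, (k : ℝ) * (L k * h (q + k) ^ 3 / 2) ≤ s₀)
    (hcap1 : ∀ q, ∑ k ∈ S₁, (k : ℝ) * (L k * h (q + k) ^ 3 / 2) ≤ s)
    {N : ℕ} {KL : ℕ → ℕ → ℕ → ℝ}
    (hKL : ∀ k n l, KL k n l = if 0 < k ∧ k < K ∧ l < k then L k * h (n + k) ^ 3 / 2 * ∏ t ∈ Ico (n + 1 + l) (n + k + 1), g t else 0)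
    {KA : ℕ → ℕ → ℕ → ℝ} {RA : ℕ → (ℕ → ℝ) → ℕ → ℝ}
    (hRA : ∀ i v m, RA i v m = ∑ l ∈ range K, KA i m l * v (m + 1 + l))
    (hKA : ∀ i m l, KA i m l = KL i m l + KA (i + 1) m l) (hKAtop : ∀ m l, KA K m l = 0)
    {e ε : ℕ → ℝ} (he0 : ∀ m, 0 ≤ e m) (hea : ∀ m, e (m + 1) ≤ e m)
    (hεt : ∀ m, N < m → ε m = 0) (hεrec : ∀ m, ε m = e m - RA 1 ε m) : ∀ m, 0 ≤ ε m ∧ ε m ≤ e m := by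
  -- a ratio that separates nothing but satisfies the older closure
  have hlam : 0 < 1 - s * (1 + κ) := by linarith
  obtain ⟨R₀, hR₀⟩ : ∃ R₀ : ℕ, κ + 4 * s * (1 + κ) ≤ (R₀ : ℝ) * (1 - s * (1 + κ)) * κ := by
    refine ⟨⌈(κ + 4 * s * (1 + κ)) / ((1 - s * (1 + κ)) * κ)⌉₊, ?_⟩
    have h1 := Nat.le_ceil ((κ + 4 * s * (1 + κ)) / ((1 - s * (1 + κ)) * κ))
    rw [div_le_iff₀ (mul_pos hlam hκ)] at h1
    linarith
  refine flow_nonneg_cluster_levels_of_caps_youngest hmono hL hb hlo hdom hh hf hg hgF hK hκ hs hsC hR₀ hρ₀ hyoung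
    (r := 2) (S := fun j => if j = 0 then S₀ else S₁) (lo := fun j => if j = 0 then 1 else lo₁) (hi := fun j => if j = 0 then hi₀ else hi₁)
    (fun j hj k hk => ?_) (fun j hj k hk => ?_) (fun j hj k hk => ?_) (fun j hj1 hjr => ?_) (fun _ => ?_) (fun j hj1 hj => by omega)
    (fun i j hij hjr => ?_) (fun l hl hno => ?_) (fun q => ?_) (fun j q hj1 hjr => ?_) hKL hRA hKA hKAtop he0 hea hεt hεrec
  · by_cases hj0 : j = 0
    · subst hj0; simp only [if_true] at hk; exact hS₀K k hk
    · simp only [if_neg hj0] at hk; exact hS₁K k hk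
  · by_cases hj0 : j = 0
    · subst hj0; simp only [if_true] at hk ⊢; exact (hS₀K k hk).1
    · simp only [if_neg hj0] at hk ⊢; exact hS₁lo k hk
  · by_cases hj0 : j = 0
    · subst hj0; simp only [if_true] at hk ⊢; exact hS₀hi k hk
    · simp only [if_neg hj0] at hk ⊢; exact hS₁hi k hk
  · have hj : j = 1 := by omega
    subst hj; simp only [show (1 : ℕ) ≠ 0 by norm_num, if_false]; exact hlohi
  · simp only [if_true, show (1 : ℕ) ≠ 0 by norm_num, if_false]; exact hgap
  · have hi0 : i = 0 := by omega
    have hj1 : j = 1 := by omega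
    subst hi0; subst hj1
    simp only [if_true, show (1 : ℕ) ≠ 0 by norm_num, if_false]
    exact disjoint_left.mpr fun x hx hx' => lt_irrefl x (hlt x hx x hx')
  · have h0 := hno 0 (by norm_num)
    have h1 := hno 1 (by norm_num)
    simp only [if_true] at h0
    simp only [show (1 : ℕ) ≠ 0 by norm_num, if_false] at h1
    exact hLS l hl h0 h1
  · simp only [if_true]; exact hcap0 q
  · have hj : j = 1 := by omega
    subst hj; simp only [show (1 : ℕ) ≠ 0 by norm_num, if_false]; exact hcap1 q

/-! ## §2 The census four ages with a near old pair at gap 33 -/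

/-- **THE CENSUS FOUR AGES `{1, k₂, k₃, k₄}` WITH A NEAR OLD PAIR ON TOP AT GAP 33: `2 ≤ k₂ ≤ 29`, `33k₂ ≤ k₃`, `k₃ < k₄ ≤ 2k₃`.**  `0 ≤ ε ≤ e` at every
pin, every horizon, every damping of the self-consistent class (`flow_nonneg_two_cluster_levels_of_caps` with `S₀ = {1, k₂}` (cap `0.8333`, (E97c)),
`S₁ = {k₃, k₄}` (cap `0.617`, (E99b)), `κ = 1∕1000`, `ρ₀ = 33`: `0.8333·(33·0.382383 + 2.471468) = 12.5746 ≤ 12.6186`; (E99f)'s ×61 version asks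
`61k₂ ≤ k₃`). [folklore] -/
theorem flow_nonneg_census_four_ages_near_old_pair_gap33
    (hmono : ∀ u v : ℕ → ℝ, SeqBox γ u → SeqBox γ v → (∀ j, u j ≤ v j) → B u ≤ B v)
    (hL : ∀ k, 0 ≤ L k) (hb : 0 < b) (hlo : ∀ u, SeqBox γ u → b ≤ B u) (hdom : ∀ u, SeqBox γ u → ∑ k ∈ range K, L k * u k ≤ B u)
    (hh : SeqBox γ h) (hf : MemFlow B gIR h) (hg : ∀ t, 0 < g t ∧ g t ≤ 1)
    (hgF : ∀ t, 1 ≤ g t * (1 + ∑ k ∈ range K, L k * h (t + k) ^ 3 / 2))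
    {k₂ k₃ k₄ : ℕ} (hk2 : 2 ≤ k₂) (hk29 : k₂ ≤ 29) (hk3 : 33 * k₂ ≤ k₃) (hk34 : k₃ < k₄) (hk4 : k₄ ≤ 2 * k₃) (hk4K : k₄ < K)
    (hLa : ∀ l, l < K → l ≠ 1 → l ≠ k₂ → l ≠ k₃ → l ≠ k₄ → L l = 0)
    {N : ℕ} {KL : ℕ → ℕ → ℕ → ℝ}
    (hKL : ∀ k n l, KL k n l = if 0 < k ∧ k < K ∧ l < k then L k * h (n + k) ^ 3 / 2 * ∏ t ∈ Ico (n + 1 + l) (n + k + 1), g t else 0)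
    {KA : ℕ → ℕ → ℕ → ℝ} {RA : ℕ → (ℕ → ℝ) → ℕ → ℝ}
    (hRA : ∀ i v m, RA i v m = ∑ l ∈ range K, KA i m l * v (m + 1 + l))
    (hKA : ∀ i m l, KA i m l = KL i m l + KA (i + 1) m l) (hKAtop : ∀ m l, KA K m l = 0)
    {e ε : ℕ → ℝ} (he0 : ∀ m, 0 ≤ e m) (hea : ∀ m, e (m + 1) ≤ e m)
    (hεt : ∀ m, N < m → ε m = 0) (hεrec : ∀ m, ε m = e m - RA 1 ε m) : ∀ m, 0 ≤ ε m ∧ ε m ≤ e m := by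
  refine flow_nonneg_two_cluster_levels_of_caps hmono hL hb hlo hdom hh hf hg hgF (by omega) (κ := 1 / 1000) (s₀ := 8333 / 10000)
    (s := 617 / 1000) (ρ₀ := 33) (by norm_num) (by norm_num) (by norm_num) (by norm_num) (by norm_num)
    (S₀ := {1, k₂}) (S₁ := {k₃, k₄}) (hi₀ := k₂) (lo₁ := k₃) (hi₁ := k₄)
    (fun k hk => ?_) (fun k hk => ?_) (fun k hk => ?_) (fun k hk => ?_) (fun k hk => ?_) hk34.le (by omega) (fun x hx y hy => ?_)
    (fun l hl h0 h1 => ?_) (fun q => ?_) (fun q => ?_) hKL hRA hKA hKAtop he0 hea hεt hεrec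
  · simp only [mem_insert, mem_singleton] at hk; rcases hk with rfl | rfl <;> omega
  · simp only [mem_insert, mem_singleton] at hk; rcases hk with rfl | rfl <;> omega
  · simp only [mem_insert, mem_singleton] at hk; rcases hk with rfl | rfl <;> omega
  · simp only [mem_insert, mem_singleton] at hk; rcases hk with rfl | rfl <;> omega
  · simp only [mem_insert, mem_singleton] at hk; rcases hk with rfl | rfl <;> omega
  · simp only [mem_insert, mem_singleton] at hx hy
    rcases hx with rfl | rfl <;> rcases hy with rfl | rfl <;> omega
  · refine hLa l hl (fun he => h0 ?_) (fun he => h0 ?_) (fun he => h1 ?_) (fun he => h1 ?_)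
    · rw [he]; exact mem_insert_self _ _
    · rw [he]; exact mem_insert_of_mem (mem_singleton_self _)
    · rw [he]; exact mem_insert_self _ _
    · rw [he]; exact mem_insert_of_mem (mem_singleton_self _)
  · rw [sum_pair (show (1 : ℕ) ≠ k₂ by omega), Nat.cast_one, one_mul]
    exact young_pair_load_le hmono hL hb hlo hdom hh hf hk2 hk29 (by omega) q
  · exact near_pair_load_le hmono hL hb hlo hdom hh hf (by omega) hk34.le hk4 hk4K q

end Summit.QuantumFields.BalabanUV.Beta.EriceRemainderEnclosureHistoryAutonomyComparisonAgeCompositionTwoClusterLevels
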